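import Mathlib.Data.Complex.Basic
import Summits.ValiantsHypothesis.ValiantsHypothesis.Theorems.LangWeilTransferShatteringExclusionJacobianCertificate
import Literature.Computability.AlgebraicComplexity.StandardFamilies
import HarnessLib

/-!
# LangWeilTransfer — crux `ShatteringExclusion` (stmt-ValiantsHypothesis-6372), line `birth` v2:
# the Jacobian certificate run end-to-end on the optimal circuit for `per_2`

Route `ValiantsHypothesis/LangWeilTransfer`, crux `ShatteringExclusion`, line
`Cruxes/ShatteringExclusion/Lines/birth.lean` v2, open stub `stub_fewBranches` (conjecture grade).
`Theorems/LangWeilTransferShatteringExclusionJacobianCertificate.lean` turns the line's point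
certificate ("the constant vector lies on exactly one irreducible component of the complexified
constants variety") into a finite check for an explicit circuit. This file RUNS that check in the
kernel on the smallest case, the optimal fan-in-two circuit `x₀₀·x₁₁ + x₀₁·x₁₀` for `per_2`
(3 gates, 13 slots; live slots: the two sum coefficients `Y₈ = Y₁₀ = 1`):

* `perTwoCircuit`, `skeleton_eval` — the circuit and its integer skeleton
  `F = Y₈·x₀₀x₁₁ + Y₁₀·x₀₁x₁₀`;
* `coeffPoly_one`, `coeffPoly_two` — the two coefficient identities `Y₈ - 1`, `Y₁₀ - 1`
  (gradients `e₈`, `e₁₀`, independent: `hjac`);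
* `phi`, `skeleton_identity`, `psi_phi`, `hq` — the 11-dimensional parametrised component
  (dead slots free, live slots `1`), through the constant vector, with algebraically independent
  coordinates; `2 + 11 = 13`;
* `perTwo_existsUnique_branch` — **the constant vector of the optimal `per_2` circuit lies on
  exactly one irreducible component of its constants variety** (the `n = 2` instance of the
  `Unibranching ⇒ FewBranches` certificate; here the variety is an affine space).

Honest framing: a sanity instance (`n = 2`) exercising the certificate API end to end; it says
nothing about `per_n` for large `n`. `stub_fewBranches`, the crux and the route stay open;
VP ≠ VNP is NOT moved.
-/

noncomputable section

open MvPolynomial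

-- the summit and the problem share the name `ValiantsHypothesis` (D-0017 single-conjunct layout)
set_option linter.dupNamespace false

namespace Summit.ValiantsHypothesis.ValiantsHypothesis.Theorems.LangWeilTransfer.ShatteringExclusion.PerTwo

open Literature.Computability.AlgebraicComplexity
open Literature.Computability.AlgebraicComplexity.ArithCircuit

/-- The optimal fan-in-two circuit for `per_2 = x₀₀x₁₁ + x₀₁x₁₀`: two product gates and one
sum gate with coefficients `1, 1`. [folklore] -/
def perTwoCircuit : ArithCircuit ℂ (Fin 2 × Fin 2) where
  gates := [.prod [.var (0,0), .var (1,1)], .prod [.var (0,1), .var (1,0)],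
    .sum [(1, .gate 0), (1, .gate 1)]]
  output := .gate 2

/-- It has three gates. [folklore] -/
theorem size_eq : perTwoCircuit.size = 3 := rfl

/-- It has fan-in two. [folklore] -/
theorem isFanInTwo : perTwoCircuit.IsFanInTwo := by
  intro g hg
  simp only [perTwoCircuit, List.mem_cons, List.mem_nil_iff, or_false] at hg
  rcases hg with rfl | rfl | rfl <;> decide

/-- `PER_2 = x₀₀ x₁₁ + x₀₁ x₁₀` (over any commutative ring). [folklore] -/
theorem perPoly_fin_two (k : Type*) [CommRing k] :
    perPoly (Fin 2) k = X (0, 0) * X (1, 1) + X (0, 1) * X (1, 0) := by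
  have huniv : (Finset.univ : Finset (Equiv.Perm (Fin 2))) = {1, Equiv.swap 0 1} := by decide
  rw [perPoly, Matrix.permanent, huniv, Finset.sum_pair (by decide), Fin.prod_univ_two,
    Fin.prod_univ_two]
  simp [Matrix.mvPolynomialX_apply, Equiv.swap_apply_left, Equiv.swap_apply_right]
  ring

/-- Its integer skeleton computes `F = Y₈ · x₀₀x₁₁ + Y₁₀ · x₀₁x₁₀` (the sum coefficients become
the slot variables `Y₈, Y₁₀`; all other slots are dead). [cite: Burgisser2000TCS, §5 (A3) p. 85] -/
theorem skeleton_eval : (skeleton perTwoCircuit).eval =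
    X (Sum.inr ⟨8, by decide⟩) * (X (Sum.inl (0,0)) * X (Sum.inl (1,1))) +
      X (Sum.inr ⟨10, by decide⟩) * (X (Sum.inl (0,1)) * X (Sum.inl (1,0))) := by
  have hg : (skeleton perTwoCircuit).gates =
      [.sum [], .sum [], .prod [.var (Sum.inl (0,0)), .var (Sum.inl (1,1))],
       .sum [], .sum [], .prod [.var (Sum.inl (0,1)), .var (Sum.inl (1,0))],
       .prod [.var (Sum.inr ⟨8, by decide⟩), .gate 2],
       .prod [.var (Sum.inr ⟨10, by decide⟩), .gate 5],
       .sum [(1, .gate 6), (1, .gate 7)]] := by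
    simp [skeleton, skelGates, skelTriple, coefGate, skelOperand, slotVar, coefSlot,
      perTwoCircuit, ArithCircuit.size]
  have ho : (skeleton perTwoCircuit).output = .gate 8 := by
    simp [skeleton, skelOperand, perTwoCircuit, ArithCircuit.size]
  rw [ArithCircuit.eval, hg, ho]
  simp [ArithCircuit.gateValues, Gate.eval, Operand.eval]

/-- Its constant vector: `1` in the live slots `8, 10`, `0` elsewhere. [folklore] -/
theorem slotConst_eq (v : Fin (4 * perTwoCircuit.size + 1)) :
    slotConst perTwoCircuit v = if (v : ℕ) = 8 ∨ (v : ℕ) = 10 then 1 else 0 := by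
  have hv : (v : ℕ) < 13 := v.2
  rcases v with ⟨v, _⟩
  simp only at hv ⊢
  interval_cases v <;> simp [slotConst, perTwoCircuit, ArithCircuit.size, operandConst]

/-- The coefficient identity at `x₀₀x₁₁` is `Y₈ - 1`. [folklore] -/
theorem coeffPoly_one :
    circuitCoeffPoly perTwoCircuit (perPoly (Fin 2) ℤ)
        (Finsupp.single (0,0) 1 + Finsupp.single (1,1) 1) = X ⟨8, by decide⟩ - 1 := by
  rw [circuitCoeffPoly_def, skeleton_eval, perPoly_fin_two]
  simp only [map_add, map_mul, sumAlgEquiv_X_inl, sumAlgEquiv_X_inr]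
  have hne : (Finsupp.single (0,1) 1 + Finsupp.single (1,0) 1 : Fin 2 × Fin 2 →₀ ℕ) ≠
      Finsupp.single (0,0) 1 + Finsupp.single (1,1) 1 := by
    intro h
    have := DFunLike.congr_fun h (0,1)
    simp at this
  have h1 : ∀ (a b : Fin 2 × Fin 2),
      (X a * X b :
          MvPolynomial (Fin 2 × Fin 2) (MvPolynomial (Fin (4 * perTwoCircuit.size + 1)) ℤ)) =
        monomial (Finsupp.single a 1 + Finsupp.single b 1) 1 := by
    intro a b
    rw [X, X, monomial_mul, one_mul]
  have h2 : ∀ (a b : Fin 2 × Fin 2),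
      (X a * X b : MvPolynomial (Fin 2 × Fin 2) ℤ) =
        monomial (Finsupp.single a 1 + Finsupp.single b 1) 1 := by
    intro a b
    rw [X, X, monomial_mul, one_mul]
  simp only [h1, h2, coeff_add, coeff_C_mul, coeff_monomial, if_true, hne, if_false, mul_one,
    mul_zero, add_zero, map_one]

/-- The coefficient identity at `x₀₁x₁₀` is `Y₁₀ - 1`. [folklore] -/
theorem coeffPoly_two :
    circuitCoeffPoly perTwoCircuit (perPoly (Fin 2) ℤ)
        (Finsupp.single (0,1) 1 + Finsupp.single (1,0) 1) = X ⟨10, by decide⟩ - 1 := by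
  rw [circuitCoeffPoly_def, skeleton_eval, perPoly_fin_two]
  simp only [map_add, map_mul, sumAlgEquiv_X_inl, sumAlgEquiv_X_inr]
  have hne : (Finsupp.single (0,0) 1 + Finsupp.single (1,1) 1 : Fin 2 × Fin 2 →₀ ℕ) ≠
      Finsupp.single (0,1) 1 + Finsupp.single (1,0) 1 := by
    intro h
    have := DFunLike.congr_fun h (0,0)
    simp at this
  have h1 : ∀ (a b : Fin 2 × Fin 2),
      (X a * X b :
          MvPolynomial (Fin 2 × Fin 2) (MvPolynomial (Fin (4 * perTwoCircuit.size + 1)) ℤ)) =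
        monomial (Finsupp.single a 1 + Finsupp.single b 1) 1 := by
    intro a b
    rw [X, X, monomial_mul, one_mul]
  have h2 : ∀ (a b : Fin 2 × Fin 2),
      (X a * X b : MvPolynomial (Fin 2 × Fin 2) ℤ) =
        monomial (Finsupp.single a 1 + Finsupp.single b 1) 1 := by
    intro a b
    rw [X, X, monomial_mul, one_mul]
  simp only [h1, h2, coeff_add, coeff_C_mul, coeff_monomial, if_true, hne, if_false, mul_one,
    mul_zero, zero_add, map_one]

/-- The two exponents `x₀₀x₁₁`, `x₀₁x₁₀`. [folklore] -/
def expo : Fin 2 → (Fin 2 × Fin 2 →₀ ℕ) :=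
  ![Finsupp.single (0,0) 1 + Finsupp.single (1,1) 1,
    Finsupp.single (0,1) 1 + Finsupp.single (1,0) 1]

/-- The two coefficient identities, read in `ℂ[Y]`. [folklore] -/
def fId (i : Fin 2) : MvPolynomial (Fin (4 * perTwoCircuit.size + 1)) ℂ :=
  MvPolynomial.map (algebraMap ℚ ℂ) (MvPolynomial.map (Int.castRingHom ℚ)
    (circuitCoeffPoly perTwoCircuit (perPoly (Fin 2) ℤ) (expo i)))

/-- The live slot hit by identity `i`: `8`, `10`. [folklore] -/
def slotOf : Fin 2 → Fin (4 * perTwoCircuit.size + 1) := ![⟨8, by decide⟩, ⟨10, by decide⟩]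

/-- `fId i = Y_{slotOf i} - 1`. [folklore] -/
theorem fId_eq (i : Fin 2) : fId i = X (slotOf i) - 1 := by
  fin_cases i
  · simp [fId, expo, slotOf, coeffPoly_one, map_sub, map_X, map_one]
  · simp [fId, expo, slotOf, coeffPoly_two, map_sub, map_X, map_one]

/-- The identities lie in the complexified coefficient ideal. [folklore] -/
theorem fId_mem (i : Fin 2) : fId i ∈ (circuitCoeffIdeal perTwoCircuit (perPoly (Fin 2) ℤ)).map
    (MvPolynomial.map (algebraMap ℚ ℂ)) :=
  Ideal.mem_map_of_mem _ (map_circuitCoeffPoly_mem _ _ _)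

/-- Gradient of identity `i` at the constant vector: the unit vector `e_{slotOf i}`. [folklore] -/
theorem grad_fId (i : Fin 2) (j : Fin (4 * perTwoCircuit.size + 1)) :
    MvPolynomial.aeval (fun v : Fin (4 * perTwoCircuit.size + 1) => slotConst perTwoCircuit v)
      (MvPolynomial.pderiv j (fId i)) = if j = slotOf i then 1 else 0 := by
  classical
  rw [fId_eq, map_sub, Derivation.map_one_eq_zero, sub_zero, pderiv_X]
  by_cases h : j = slotOf i
  · subst h; simp
  · rw [Pi.single_eq_of_ne (Ne.symm h), map_zero, if_neg h]

/-- The two gradients are linearly independent (Jacobian rank `2`). [folklore] -/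
theorem hjac : LinearIndependent ℂ (fun i : Fin 2 => fun j : Fin (4 * perTwoCircuit.size + 1) =>
    MvPolynomial.aeval (fun v : Fin (4 * perTwoCircuit.size + 1) => slotConst perTwoCircuit v)
      (MvPolynomial.pderiv j (fId i))) := by
  have hv : (fun i : Fin 2 => fun j : Fin (4 * perTwoCircuit.size + 1) =>
      MvPolynomial.aeval (fun v : Fin (4 * perTwoCircuit.size + 1) => slotConst perTwoCircuit v)
        (MvPolynomial.pderiv j (fId i))) = fun i j => if j = slotOf i then (1 : ℂ) else 0 := by
    funext i j; exact grad_fId i j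
  rw [hv, linearIndependent_fin2]
  constructor
  · intro h
    have := congr_fun h (slotOf 1)
    simp at this
  · intro a h
    have := congr_fun h (slotOf 0)
    simp [slotOf] at this

/-- The parametrisation of the component through the constant vector: live slots `1`, dead
slots free. [folklore] -/
def phiFun (j : Fin (4 * perTwoCircuit.size + 1)) :
    MvPolynomial (Fin (4 * perTwoCircuit.size + 1)) ℂ :=
  if (j : ℕ) = 8 ∨ (j : ℕ) = 10 then 1 else X j

/-- The parametrisation as a `ℂ`-algebra map `ℂ[Y] → ℂ[Y]`. [folklore] -/
def phi : MvPolynomial (Fin (4 * perTwoCircuit.size + 1)) ℂ →ₐ[ℂ]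
    MvPolynomial (Fin (4 * perTwoCircuit.size + 1)) ℂ :=
  MvPolynomial.aeval phiFun

/-- Values of the parametrisation on the slot variables. [folklore] -/
theorem phi_X (j : Fin (4 * perTwoCircuit.size + 1)) : phi (X j) = phiFun j := by
  simp [phi]

/-- The parametrised point satisfies the skeleton identity `F(x, φ(Y)) = per_2`. [folklore] -/
theorem skeleton_identity :
    MvPolynomial.aeval (Sum.elim MvPolynomial.X fun v => MvPolynomial.C (phi (MvPolynomial.X v)) :
        (Fin 2 × Fin 2) ⊕ Fin (4 * perTwoCircuit.size + 1) →
          MvPolynomial (Fin 2 × Fin 2) (MvPolynomial (Fin (4 * perTwoCircuit.size + 1)) ℂ))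
      (skeleton perTwoCircuit).eval =
    MvPolynomial.map (Int.castRingHom _) (perPoly (Fin 2) ℤ) := by
  rw [map_perPoly, perPoly_fin_two, skeleton_eval]
  simp [phi_X, phiFun]

/-- Specialisation `ℂ[Y] → ℂ` at the origin. [folklore] -/
def psi : MvPolynomial (Fin (4 * perTwoCircuit.size + 1)) ℂ →ₐ[ℂ] ℂ :=
  MvPolynomial.aeval fun _ => 0

/-- The parametrised point specialises to the constant vector. [folklore] -/
theorem psi_phi (v : Fin (4 * perTwoCircuit.size + 1)) :
    psi (phi (MvPolynomial.X v)) = slotConst perTwoCircuit v := by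
  rw [phi_X, slotConst_eq, phiFun]
  split_ifs with h <;> simp [psi]

/-- The eleven dead slots `0..7, 9, 11, 12`. [folklore] -/
def deadSlot : Fin 11 → Fin (4 * perTwoCircuit.size + 1) :=
  ![⟨0, by decide⟩, ⟨1, by decide⟩, ⟨2, by decide⟩, ⟨3, by decide⟩, ⟨4, by decide⟩, ⟨5, by decide⟩,
    ⟨6, by decide⟩, ⟨7, by decide⟩, ⟨9, by decide⟩, ⟨11, by decide⟩, ⟨12, by decide⟩]

/-- The dead slots are distinct. [folklore] -/
theorem deadSlot_injective : Function.Injective deadSlot := by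
  decide

/-- The parametrisation is the identity on dead slots. [folklore] -/
theorem phi_X_deadSlot (i : Fin 11) : phi (X (deadSlot i)) = X (deadSlot i) := by
  rw [phi_X, phiFun, if_neg]
  fin_cases i <;> decide

/-- The eleven dead-slot coordinates of the parametrised point are algebraically independent (so
its closed image has dimension `≥ 11`). [folklore] -/
theorem hq : AlgebraicIndependent ℂ (fun i : Fin 11 => phi (X (deadSlot i))) := by
  have h := (MvPolynomial.algebraicIndependent_X (Fin (4 * perTwoCircuit.size + 1)) ℂ).comp
    deadSlot deadSlot_injective
  convert h using 1
  funext i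
  exact phi_X_deadSlot i

/-- **The constant vector of the optimal `per_2` circuit lies on exactly one irreducible component
of its complexified constants variety** — the Jacobian certificate of
`…JacobianCertificate.existsUnique_minimalPrimes_le_ker_of_jacobian_certificate` with `r = 2`
identities (`Y₈ - 1`, `Y₁₀ - 1`) and the `e = 11`-dimensional family of dead slots.
[cite: Hartshorne1977, Thm. I.5.1] -/
theorem perTwo_existsUnique_branch :
    ∃! 𝔓 : Ideal (MvPolynomial (Fin (4 * perTwoCircuit.size + 1)) ℂ),
      𝔓 ∈ ((circuitCoeffIdeal perTwoCircuit (perPoly (Fin 2) ℤ)).map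
        (MvPolynomial.map (algebraMap ℚ ℂ))).minimalPrimes ∧
        𝔓 ≤ RingHom.ker (MvPolynomial.aeval
          (fun v : Fin (4 * perTwoCircuit.size + 1) => slotConst perTwoCircuit v) :
            MvPolynomial (Fin (4 * perTwoCircuit.size + 1)) ℂ →ₐ[ℂ] ℂ) :=
  existsUnique_minimalPrimes_le_ker_of_jacobian_certificate
    perTwoCircuit (perPoly (Fin 2) ℤ) (r := 2) (e := 11) (by decide) fId fId_mem hjac phi
    skeleton_identity psi psi_phi (fun i => X (deadSlot i)) hq

end Summit.ValiantsHypothesis.ValiantsHypothesis.Theorems.LangWeilTransfer.ShatteringExclusion.PerTwo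

end
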